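import Summits.ABC.IUTFork.LanaProcedure
import Summits.ABC.IUTFork.LanaWitnesses
import Summits.ABC.IUTFork.LanaRssChecks
import HarnessLib

/-!
# L-LANA objects XIII bis: the assembled §8.1 procedure is inhabited, with (9-1) true in one model and false in another

Record-only file (D-0012) of the abc-iut cell (seat abc-iut-c312-4, L-LANA level; vacuity audit of the
assembly `LanaProcedure`); TAKES NO SIDE on [IUTchIII] Cor. 3.12. Over the real `ℚ_p` reference datum
(`LanaWitnesses.padicBigH`), the trivial Θ-value-action signature (`EtaSteps.trivial`, containment holds) and
the counting-measure `η`-data of `LanaRssChecks`: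

* `exactProcedure p` — a `LanaProcedure` in which (9-1) HOLDS, hence (8-1) (`exactProcedure_cor312`);
* `strictProcedure p` — a `LanaProcedure` in which (8-1) HOLDS but (9-1) FAILS (`strictProcedure_gap`).

So every hypothesis field of the assembly is satisfiable by real objects, and the assembled types do not
decide (9-1) either way — it is exactly the open input (LANA §10.5 p. 49: "not manifestly false … we do not
have a proof of (9-1) at this time"). [cite: LANA2026Report, §8.1 pp. 40–41, §10.5 p. 49] NOT here: any judgement.
-/

noncomputable section

open MeasureTheory

namespace Summit.ABC
namespace IUTFork

variable (p : ℕ) [Fact p.Prime]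

/-- The §8.1 procedure assembled over the `ℚ_p` witness big-H, trivial η-signatures, and the EXACT
counting-measure `η`-datum ((9-1) holds). [cite: LANA2026Report, §8.1 pp. 40–41] -/
def exactProcedure : LanaProcedure (refOne p) Finset.univ RssChecks.μ₂ where
  bigH := padicBigH p
  eta _ := EtaSteps.trivial
  containment _ := EtaSteps.trivial_containment
  E := RssChecks.exactModel
  suitableInHull _ _ := Set.subset_univ _

/-- In `exactProcedure`, (9-1) holds … [cite: LANA2026Report, §9.2 (9-1) p. 46] -/
theorem exactProcedure_mainGoal : (exactProcedure p).MainGoal := RssChecks.exactModel_mainGoal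

/-- … hence (8-1) (`LanaProcedure.cor312_of_mainGoal`). [cite: LANA2026Report, §9 p. 44] -/
theorem exactProcedure_cor312 : (exactProcedure p).Cor312 :=
  (exactProcedure p).cor312_of_mainGoal (exactProcedure_mainGoal p)

/-- The §8.1 procedure assembled over the same data but the STRICT `η`-datum ((8-1) true, (9-1) false).
[cite: LANA2026Report, §8.1 pp. 40–41] -/
def strictProcedure : LanaProcedure (refOne p) Finset.univ RssChecks.μ₂ where
  bigH := padicBigH p
  eta _ := EtaSteps.trivial
  containment _ := EtaSteps.trivial_containment
  E := RssChecks.strictModel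
  suitableInHull := RssChecks.strictModel_suitableInHull

/-- In `strictProcedure`, (8-1) holds while (9-1) fails: the assembly does not decide (9-1).
[cite: LANA2026Report, §10.5 p. 49] -/
theorem strictProcedure_gap : (strictProcedure p).Cor312 ∧ ¬ (strictProcedure p).MainGoal :=
  ⟨RssChecks.strictModel_cor312, RssChecks.strictModel_not_mainGoal⟩

end IUTFork
end Summit.ABC

end
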